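import Summits.HodgeConjecture.HodgeConjecture.Theorems.EightfoldBlochSeedsBlochSeedsGenericRegularImmersionOfStalks
import Literature.AlgebraicGeometry.Resolution.RegularCentreRsopPart
import Literature.AlgebraicGeometry.Resolution.RegularLocalRingsProofs
import Literature.AlgebraicGeometry.Resolution.SmoothStalksRegular
import Literature.AlgebraicGeometry.Resolution.ResolutionGlue
import Mathlib.AlgebraicGeometry.Noetherian
import HarnessLib

/-!
# Route `EightfoldBlochSeeds`, cruxes `BlochSeedsGeneric` / `BlochSeedDiscThree` (items stmt-HodgeConjecture-18880 / 18882),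
# stub `stub_pad4_carrier`: A REGULAR CLOSED SUBSCHEME OF A SCHEME WITH REGULAR LOCAL RINGS IS A REGULAR IMMERSION
# (EGA IV 17.12.1 / Matsumura 14.2 — brick K5 of the road to the named fact `kleiman1969_smoothingCycles_eightfold_codimFour`)

HONEST FRAMING. `--supports` helper; nothing here proves the stub, (K), the crux, H2, HC_AV or HC. No definition, no named
fact (D-0026).

WHAT. (K) asserts that Kleiman's smooth connected degeneracy locus `D ⊂ X` is `IsRegularImmersionOfCodim _ 4`; `D` is
determinantal, so the local complete intersection property comes ONLY from «smooth ⊂ smooth ⟹ regular immersion». This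
file proves the tree-level form of that implication:

* `IsRsopPart.isWeaklyRegular_ofFn` — a part of a regular system of parameters of a (regular) local ring is a weakly
  regular sequence in Mathlib's sense (from the tree's `Resolution.isRegular_of_span_eq_maximalIdeal`, Matsumura 14.2–14.3);
* `isRegularImmersionOfCodim_of_isRegular_subscheme` — **K5**: on a locally Noetherian `X`, a closed immersion
  `i : Z ⟶ X` whose image has regular local rings `𝒪_{X, i z}`, whose subscheme `V(𝓘)` (`𝓘 = i.ker`) is a regular scheme,
  and with `dim 𝒪_{X,iz} = dim (𝒪_{X,iz}/𝓘_{iz}) + p` at every point, is a regular immersion of codimension `p`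
  (`Resolution.exists_isRsopPart_fin_span_range_eq_stalkIdeal` = Matsumura 14.2 at the stalks, then
  `isRegularImmersionOfCodim_of_stalkIdeal_eq_span` = the spreading of this hand's two previous files).
* `isRegularImmersionOfCodim_of_smooth_of_ringKrullDim` — **K5, smooth form**: `X` smooth over a field `k`, `i : Z ⟶ X` a
  closed immersion with `Z` smooth over `k`, and the dimension formula at the stalks ⟹ `IsRegularImmersionOfCodim i p`
  (regular stalks by the tree's `Resolution.isRegularLocalRing_stalk_of_smooth_of_field`, transported to `V(i.ker) ≅ Z` by
  `Scheme.IsRegular.of_iso`). What remains for (K)'s consumer is dimension bookkeeping only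
  (`dim 𝒪_{X,x} = dim 𝒪_{D,x} + 4` for Kleiman's fourfold `D` in the eightfold `X`).

[cite: EGAIV4, Prop. 17.12.1] [cite: Matsumura1987, Thm. 14.2, Thm. 14.3 and §16] [cite: GortzWedhorn2023, Def. 19.19]
-/

noncomputable section

-- single-problem summit (Problem = Summit): the mandated namespace repeats `HodgeConjecture`.
set_option linter.dupNamespace false

open CategoryTheory AlgebraicGeometry TopologicalSpace IsLocalRing
open Literature.AlgebraicGeometry.HodgeTheory Literature.AlgebraicGeometry.Resolution

namespace Summit.HodgeConjecture.HodgeConjecture.Theorems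

universe u

open RingTheory.Sequence in
/-- **A part of a regular system of parameters is a weakly regular sequence** (Mathlib currency `IsWeaklyRegular`): extend
`z` to a full regular system of parameters `x` (`IsRsopPart.exists_rsop`), which is an `R`-sequence
(`Resolution.isRegular_of_span_eq_maximalIdeal`, Matsumura 14.2–14.3), and keep the initial segment
(`isWeaklyRegular_append_iff`). [cite: Matsumura1987, Thm. 14.2 and Thm. 14.3] -/
theorem IsRsopPart.isWeaklyRegular_ofFn {R : Type u} [CommRing R] [IsLocalRing R] {n : ℕ} {z : Fin n → R}
    (hz : IsRsopPart z) : IsWeaklyRegular R (List.ofFn z) := by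
  haveI := hz.isRegularLocalRing
  obtain ⟨e, x, hrank, hspan, hxz⟩ := hz.exists_rsop
  have hlen : (List.ofFn x).length = ringKrullDim R := by
    rw [List.length_ofFn, ← IsRegularLocalRing.spanFinrank_maximalIdeal, hrank]
  have hofList : Ideal.ofList (List.ofFn x) = Ideal.span (Set.range x) := by
    rw [Ideal.ofList]
    congr 1
    ext r
    simp [List.mem_ofFn']
  have hreg := isRegular_of_span_eq_maximalIdeal R (List.ofFn x) (by rw [hofList, hspan]) hlen
  have hw := hreg.toIsWeaklyRegular
  rw [List.ofFn_add] at hw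
  have h1 := ((isWeaklyRegular_append_iff R _ _).1 hw).1
  convert h1 using 2
  exact funext fun i => (hxz i).symm

/-- **K5 — a regular closed subscheme of a scheme with regular local rings is a regular immersion of the codimension
given by the dimension formula** (EGA IV 17.12.1 via Matsumura 14.2): `X` locally Noetherian, `i : Z ⟶ X` a closed
immersion, `𝒪_{X, i z}` regular for all `z`, `V(i.ker)` a regular scheme, and `dim (𝒪_{X,iz} ⧸ 𝓘_{iz}) + p = dim 𝒪_{X,iz}`
for all `z`; then `IsRegularImmersionOfCodim i p`. (For `Z`, `X` smooth over a field: regular stalks by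
`Resolution.isRegularLocalRing_stalk_of_smooth_of_field`; this is the clause of (K) for Kleiman's smooth degeneracy locus.)
[cite: EGAIV4, Prop. 17.12.1] [cite: Matsumura1987, Thm. 14.2] [cite: GortzWedhorn2023, Def. 19.19] -/
theorem isRegularImmersionOfCodim_of_isRegular_subscheme {X Z : Scheme.{u}} [IsLocallyNoetherian X] (i : Z ⟶ X)
    [IsClosedImmersion i] {p : ℕ} (hX : ∀ z : Z, IsRegularLocalRing (X.presheaf.stalk (i.base z)))
    (hZ : Scheme.IsRegular i.ker.subscheme)
    (hdim : ∀ z : Z, ringKrullDim (X.presheaf.stalk (i.base z) ⧸ stalkIdeal i.ker (i.base z)) + p =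
      ringKrullDim (X.presheaf.stalk (i.base z))) :
    IsRegularImmersionOfCodim i p := by
  refine isRegularImmersionOfCodim_of_stalkIdeal_eq_span i fun z => ?_
  haveI := hX z
  have hx : i.base z ∈ i.ker.support := i.range_subset_ker_support ⟨z, rfl⟩
  obtain ⟨c, hc, hspan⟩ := exists_isRsopPart_fin_span_range_eq_stalkIdeal hZ hx (hdim z)
  exact ⟨c, IsRsopPart.isWeaklyRegular_ofFn hc, hspan⟩

/-- **K5, smooth form — a closed subscheme smooth over a field of a scheme smooth over that field is a regular immersion,
of the codimension given by the dimension formula at the stalks** (EGA IV 17.12.1). `X` is locally Noetherian (finite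
type over a field), its stalks and those of `Z ≅ V(i.ker)` are regular (`Resolution.isRegularLocalRing_stalk_of_smooth_of_field`,
`Scheme.IsRegular.of_iso` along `i.toImage`), so `isRegularImmersionOfCodim_of_isRegular_subscheme` applies. This is the
`IsRegularImmersionOfCodim _ 4` clause of (K) for Kleiman's smooth connected degeneracy fourfold, up to the dimension count.
[cite: EGAIV4, Prop. 17.12.1] [cite: StacksProject, Tag 056S] [cite: GortzWedhorn2023, Def. 19.19] -/
theorem isRegularImmersionOfCodim_of_smooth_of_ringKrullDim {k : Type u} [Field k] {X Z : Scheme.{u}}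
    (f : X ⟶ Spec (CommRingCat.of k)) [Smooth f] (i : Z ⟶ X) [IsClosedImmersion i] [Smooth (i ≫ f)] {p : ℕ}
    (hdim : ∀ z : Z, ringKrullDim (X.presheaf.stalk (i.base z) ⧸ stalkIdeal i.ker (i.base z)) + p =
      ringKrullDim (X.presheaf.stalk (i.base z))) :
    IsRegularImmersionOfCodim i p := by
  haveI : IsLocallyNoetherian X := LocallyOfFiniteType.isLocallyNoetherian f
  have hZreg : Scheme.IsRegular Z := fun z => isRegularLocalRing_stalk_of_smooth_of_field (i ≫ f) z
  have hker : Scheme.IsRegular i.ker.subscheme := Scheme.IsRegular.of_iso i.toImage hZreg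
  exact isRegularImmersionOfCodim_of_isRegular_subscheme i
    (fun z => isRegularLocalRing_stalk_of_smooth_of_field f (i.base z)) hker hdim

end Summit.HodgeConjecture.HodgeConjecture.Theorems

end

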